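import Summits.AtomisticToContinuum.Crystallization.Theorems.ChartedZeroExcessLayeredLatticeLiouvilleZZZYRCXRWF

/-!
# Charted zero-excess layered lattice Liouville — RCXRWG: the decided DOMINATION CERTIFICATE of a class envelope (lens-2 g101)

Q-K design (i) wants ONE common table pair dominating every type's tables.  With RCXRWF the type's tables are class envelopes
`envTab σ (pinRep H₀ g u₀) g₀ g₁ (outTR yms T)` (+ the reflected down class) and domination is needed on the finite key box only.
Here the common tables are LOOKUPS IN A PAYLOAD TREE (`comTR/comTN H₀ BU BD k = find (codeKO k) BU + find (codeKO (revKey k)) BD`,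
the trees emitted by the census as literals), and `domChk` is a Bool certificate, linear in the unit table, whose truth implies the
domination of one class envelope by one tree on the key box (`dom_of_domChk`):

* §1 the aggregating merge `mergeAgg` of code-sorted tables and `aggAll` (all far layers of a unit in one table): `outTR yms T k =
  tabR (aggAll T yms) (codeKO k)` EXACTLY (no sortedness needed for the identity);
* §2 code digits, candidate `g`-values read off a code, the un-shift of a key, the certificate `domChk` and ★ `dom_of_domChk`
  (tree lookups, the common tables and `strictCodes` are RCXRWF §3–§4);
* §3 ★★ `kernelSlabSoundFE_common`: class door output + two certificates ⇒ the type contract with the COMMON tables; §4 toys.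

Cost of one certificate: `O(|unit table| · 4 · depth(tree))` kernel steps; 192 certificates for the 16 half-word units × 6 letter
symmetries × 2 directions.  [g101]
-/

namespace Summit.AtomisticToContinuum.Crystallization.Theorems.ChartedZeroExcessLayeredLatticeLiouville.ThetaKernel

open scoped BigOperators

/-! ### §1 the aggregating merge -/

/-- one run of the aggregating merge: place `e` (continuation `rest` merges what follows `e` on the left). [g101] -/
def mergeStep (e : ℕ × ℕ × ℕ) (rest : List (ℕ × ℕ × ℕ) → List (ℕ × ℕ × ℕ)) : List (ℕ × ℕ × ℕ) → List (ℕ × ℕ × ℕ)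
  | [] => e :: rest []
  | f :: M' => bif Nat.blt e.1 f.1 then e :: rest (f :: M')
      else bif Nat.blt f.1 e.1 then f :: mergeStep e rest M'
      else (e.1, e.2.1 + f.2.1, e.2.2 + f.2.2) :: rest M'

/-- ★ aggregating merge of two code-sorted tables (payloads of equal codes are summed). [g101] -/
def mergeAgg : List (ℕ × ℕ × ℕ) → List (ℕ × ℕ × ℕ) → List (ℕ × ℕ × ℕ)
  | [] => fun M => M
  | e :: L' => mergeStep e (mergeAgg L')

/-- all far-layer tables of a unit merged into one. [g101] -/
def aggAll (T : ℕ → List (ℕ × ℕ × ℕ)) : List ℕ → List (ℕ × ℕ × ℕ)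
  | [] => []
  | ym :: r => mergeAgg (T ym) (aggAll T r)

/-- `mergeStep` preserves the key-wise sums (any lists). [g101] -/
theorem tab_mergeStep (e : ℕ × ℕ × ℕ) {L' : List (ℕ × ℕ × ℕ)} {rest : List (ℕ × ℕ × ℕ) → List (ℕ × ℕ × ℕ)}
    (hrest : ∀ M q, tabR (rest M) q = tabR L' q + tabR M q ∧ tabN (rest M) q = tabN L' q + tabN M q) :
    ∀ M q, tabR (mergeStep e rest M) q = tabR (e :: L') q + tabR M q ∧ tabN (mergeStep e rest M) q = tabN (e :: L') q + tabN M q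
  | [], q => by
    obtain ⟨h1, h2⟩ := hrest [] q
    simp only [mergeStep, tabR_cons, tabN_cons, h1, h2]
    simp [tabR, tabN]
  | f :: M', q => by
    obtain ⟨h1, h2⟩ := hrest (f :: M') q
    obtain ⟨h3, h4⟩ := hrest M' q
    obtain ⟨h5, h6⟩ := tab_mergeStep e hrest M' q
    simp only [mergeStep]
    cases hef : Nat.blt e.1 f.1
    · cases hfe : Nat.blt f.1 e.1
      · have heq : e.1 = f.1 := by
          have a1 : ¬ e.1 < f.1 := fun hlt => by
            have : Nat.blt e.1 f.1 = true := by simp only [Nat.blt_eq]; exact hlt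
            rw [hef] at this; exact Bool.false_ne_true this
          have a2 : ¬ f.1 < e.1 := fun hlt => by
            have : Nat.blt f.1 e.1 = true := by simp only [Nat.blt_eq]; exact hlt
            rw [hfe] at this; exact Bool.false_ne_true this
          omega
        simp only [cond_false, tabR_cons, tabN_cons, h3, h4]
        constructor <;> split_ifs <;> omega
      · simp only [cond_false, cond_true, tabR_cons, tabN_cons, h5, h6]
        constructor <;> omega
    · simp only [cond_true, tabR_cons, tabN_cons, h1, h2]
      constructor <;> omega

/-- ★ `mergeAgg` preserves the key-wise sums (any lists). [g101] -/
theorem tab_mergeAgg : ∀ (L M : List (ℕ × ℕ × ℕ)) (q : ℕ),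
    tabR (mergeAgg L M) q = tabR L q + tabR M q ∧ tabN (mergeAgg L M) q = tabN L q + tabN M q
  | [], M, q => by simp [mergeAgg, tabR, tabN]
  | e :: L', M, q => by
    simp only [mergeAgg]
    exact tab_mergeStep e (fun M q => tab_mergeAgg L' M q) M q

/-- ★ THE OUT TABLES ARE LOOKUPS IN THE MERGED TABLE: `outTR yms T k = tabR (aggAll T yms) (codeKO k)` (same for N). [g101] -/
theorem outT_eq_aggAll (T : ℕ → List (ℕ × ℕ × ℕ)) (k : ℤ × ℤ × ℤ × ℤ) : ∀ yms : List ℕ,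
    outTR yms T k = (tabR (aggAll T yms) (codeKO k) : ℤ) ∧ outTN yms T k = (tabN (aggAll T yms) (codeKO k) : ℤ)
  | [] => by simp [outTR, outTN, aggAll, tabR, tabN]
  | ym :: r => by
    obtain ⟨h1, h2⟩ := outT_eq_aggAll T k r
    obtain ⟨h3, h4⟩ := tab_mergeAgg (T ym) (aggAll T r) (codeKO k)
    simp only [outTR, outTN, List.map_cons, List.sum_cons] at h1 h2 ⊢
    simp only [aggAll, h3, h4]
    push_cast
    rw [← h1, ← h2]
    exact ⟨rfl, rfl⟩

/-! ### §2 digits, candidates, un-shift, the certificate -/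

/-- first digit (start layer `+ 600`) of a code. [g101] -/
def dg0 (q : ℕ) : ℕ := q / 1732323601
/-- second digit (`Δγ₀ + 600`). [g101] -/
def dg1 (q : ℕ) : ℕ := q / 1442401 % 1201
/-- third digit (`Δγ₁ + 600`). [g101] -/
def dg2 (q : ℕ) : ℕ := q / 1201 % 1201
/-- fourth digit (`Δm + 600`). [g101] -/
def dg3 (q : ℕ) : ℕ := q % 1201

/-- ★ the digits of the code of a key with coordinates in `[−600, 600]` are the shifted coordinates. [g101] -/
theorem digits_codeKO {k : ℤ × ℤ × ℤ × ℤ} (h1 : -600 ≤ k.1) (h1' : k.1 ≤ 600) (h2 : -600 ≤ k.2.1) (h2' : k.2.1 ≤ 600)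
    (h3 : -600 ≤ k.2.2.1) (h3' : k.2.2.1 ≤ 600) (h4 : -600 ≤ k.2.2.2) (h4' : k.2.2.2 ≤ 600) :
    (dg0 (codeKO k) : ℤ) = k.1 + 600 ∧ (dg1 (codeKO k) : ℤ) = k.2.1 + 600 ∧ (dg2 (codeKO k) : ℤ) = k.2.2.1 + 600 ∧
      (dg3 (codeKO k) : ℤ) = k.2.2.2 + 600 := by
  obtain ⟨d, a, b, m⟩ := k
  simp only at h1 h1' h2 h2' h3 h3' h4 h4' ⊢
  unfold codeKO dg0 dg1 dg2 dg3
  simp only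
  refine ⟨?_, ?_, ?_, ?_⟩ <;> omega

/-- the candidate `g`-values read off a layer digit `D = m + 600`: the representative's pinned value on the up half-window, else both. [g101] -/
def candAt (H₀ : ℕ) (g : ℤ → ℤ) (u₀ : List ℕ) (g₀ g₁ : ℤ) (D : ℕ) : List ℤ :=
  bif Nat.ble (600 + H₀) D && Nat.ble D (600 + 2 * H₀) then [g ((u₀.getD (D - 600 - H₀) 0 : ℕ) : ℤ)] else [g₀, g₁]

/-- ★ the candidate pair of `gCand (pinRep …)` at layer `m ≥ −600` is listed by `candAt` at the digit `m + 600`. [g101] -/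
theorem mem_candAt {H₀ : ℕ} {g : ℤ → ℤ} {u₀ : List ℕ} {g₀ g₁ : ℤ} {m : ℤ} (hm : -600 ≤ m) {x : ℤ}
    (hx : x = (gCand (pinRep H₀ g u₀) g₀ g₁ m).1 ∨ x = (gCand (pinRep H₀ g u₀) g₀ g₁ m).2) :
    x ∈ candAt H₀ g u₀ g₀ g₁ (m + 600).toNat := by
  unfold candAt
  unfold gCand pinRep at hx
  by_cases hc : (H₀ : ℤ) ≤ m ∧ m ≤ 2 * (H₀ : ℤ)
  · simp only [if_pos hc] at hx
    have hb : (Nat.ble (600 + H₀) (m + 600).toNat && Nat.ble (m + 600).toNat (600 + 2 * H₀)) = true := by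
      rw [Bool.and_eq_true, Nat.ble_eq, Nat.ble_eq]; omega
    have hi : (m + 600).toNat - 600 - H₀ = m.toNat - H₀ := by omega
    rw [hb, cond_true, hi]
    rcases hx with rfl | rfl <;> simp
  · simp only [if_neg hc] at hx
    have hb : (Nat.ble (600 + H₀) (m + 600).toNat && Nat.ble (m + 600).toNat (600 + 2 * H₀)) = false := by
      rw [Bool.eq_false_iff, Ne, Bool.and_eq_true, Nat.ble_eq, Nat.ble_eq]; omega
    rw [hb, cond_false]
    rcases hx with rfl | rfl <;> simp

/-- the un-shift of a transported key for the sign `σ` and the value shift `s = v − u`. [g101] -/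
def unshiftK (σ s : ℤ) (κ : ℤ × ℤ × ℤ × ℤ) : ℤ × ℤ × ℤ × ℤ := (κ.1, σ * κ.2.1 + s, σ * κ.2.2.1 + s, κ.2.2.2)

/-- `unshiftK` undoes the key transport of `symTabAt`. [g101] -/
theorem unshiftK_shift {σ : ℤ} (hσ2 : σ * σ = 1) (d a b m u v : ℤ) :
    unshiftK σ (v - u) (d, σ * (a - (v - u)), σ * (b - (v - u)), m) = (d, a, b, m) := by
  simp only [unshiftK, Prod.mk.injEq]
  refine ⟨trivial, ?_, ?_, trivial⟩
  · rw [← mul_assoc, hσ2, one_mul, sub_add_cancel]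
  · rw [← mul_assoc, hσ2, one_mul, sub_add_cancel]

/-- the per-entry check: for every candidate pair at the entry's two layers, the un-shifted key's tree payloads majorise the entry. [g101] -/
noncomputable def domEntryChk (H₀ : ℕ) (σ : ℤ) (g : ℤ → ℤ) (u₀ : List ℕ) (g₀ g₁ : ℤ) (B : PT) (e : ℕ × ℕ × ℕ) : Bool :=
  (candAt H₀ g u₀ g₀ g₁ (dg0 e.1)).all fun a => (candAt H₀ g u₀ g₀ g₁ (dg0 e.1 + dg3 e.1 - 600)).all fun b =>
    Nat.ble e.2.1 (PT.findR (codeKO (unshiftK σ (b - a)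
        ((dg0 e.1 : ℤ) - 600, (dg1 e.1 : ℤ) - 600, (dg2 e.1 : ℤ) - 600, (dg3 e.1 : ℤ) - 600))) B) &&
      Nat.ble e.2.2 (PT.findN (codeKO (unshiftK σ (b - a)
        ((dg0 e.1 : ℤ) - 600, (dg1 e.1 : ℤ) - 600, (dg2 e.1 : ℤ) - 600, (dg3 e.1 : ℤ) - 600))) B)

/-- the value-range check of the `g`-data (keeps transported keys inside the digit range). [g101] -/
def gRangeChk (g : ℤ → ℤ) (u₀ : List ℕ) (g₀ g₁ : ℤ) : Bool :=
  decide (|g₀| ≤ 1) && decide (|g₁| ≤ 1) && decide (|g 0| ≤ 1) && u₀.all fun n => decide (|g (n : ℤ)| ≤ 1)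

/-- ★★ THE DOMINATION CERTIFICATE of the class `(u₀, σ, g, g₀, g₁)` of the unit `(yms, T)` against the tree `B`. [g101] -/
noncomputable def domChk (H₀ : ℕ) (σ : ℤ) (g : ℤ → ℤ) (u₀ : List ℕ) (g₀ g₁ : ℤ) (yms : List ℕ) (T : ℕ → List (ℕ × ℕ × ℕ))
    (B : PT) : Bool :=
  gRangeChk g u₀ g₀ g₁ && strictCodes (aggAll T yms) && (aggAll T yms).all (domEntryChk H₀ σ g u₀ g₀ g₁ B)

/-- the range check bounds every candidate value by `1` in absolute value. [g101] -/
theorem abs_gCand_le {H₀ : ℕ} {g : ℤ → ℤ} {u₀ : List ℕ} {g₀ g₁ : ℤ} (h : gRangeChk g u₀ g₀ g₁ = true) (m : ℤ) :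
    |(gCand (pinRep H₀ g u₀) g₀ g₁ m).1| ≤ 1 ∧ |(gCand (pinRep H₀ g u₀) g₀ g₁ m).2| ≤ 1 := by
  unfold gRangeChk at h
  simp only [Bool.and_eq_true, decide_eq_true_eq, List.all_eq_true] at h
  obtain ⟨⟨⟨h0, h1⟩, hz⟩, hall⟩ := h
  have hget : ∀ i, |g ((u₀.getD i 0 : ℕ) : ℤ)| ≤ 1 := by
    intro i
    by_cases hi : i < u₀.length
    · rw [List.getD_eq_getElem _ _ hi]; exact hall _ (List.getElem_mem hi)
    · rw [List.getD_eq_default _ _ (not_lt.mp hi)]; exact_mod_cast hz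
  unfold gCand pinRep
  by_cases hc : (H₀ : ℤ) ≤ m ∧ m ≤ 2 * (H₀ : ℤ)
  · simp only [if_pos hc]; exact ⟨hget _, hget _⟩
  · simp only [if_neg hc]; exact ⟨h0, h1⟩

/-- ★★★ SOUNDNESS OF THE CERTIFICATE: on the key box the class envelope of the unit's out tables is dominated by the tree. [g101] -/
theorem dom_of_domChk {H₀ R G Mp : ℕ} {σ g₀ g₁ : ℤ} {g : ℤ → ℤ} {u₀ : List ℕ} {yms : List ℕ} {T : ℕ → List (ℕ × ℕ × ℕ)}
    {B : PT} (hσ2 : σ * σ = 1) (hHR : H₀ + R ≤ 600) (hG : G + 2 ≤ 600) (hRM : R + Mp ≤ 600)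
    (hchk : domChk H₀ σ g u₀ g₀ g₁ yms T B = true) (k : ℤ × ℤ × ℤ × ℤ) (hk : InKeyBox H₀ R G Mp k) :
    envTab σ (pinRep H₀ g u₀) g₀ g₁ (outTR yms T) k ≤ (PT.findR (codeKO k) B : ℤ) ∧
      envTab σ (pinRep H₀ g u₀) g₀ g₁ (outTN yms T) k ≤ (PT.findN (codeKO k) B : ℤ) := by
  unfold domChk at hchk
  simp only [Bool.and_eq_true] at hchk
  obtain ⟨⟨hrg, hstrict⟩, hall⟩ := hchk
  rw [List.all_eq_true] at hall
  obtain ⟨d, a0, a1, dm⟩ := k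
  obtain ⟨hk1, hk2, hk3, hk4⟩ := hk
  simp only at hk1 hk2 hk3 hk4
  rw [abs_le] at hk1 hk2 hk3 hk4
  have hσabs : |σ| = 1 := Int.eq_one_of_mul_eq_one_right (abs_nonneg σ) (by rw [← abs_mul, hσ2, abs_one])
  have hbnd : ∀ x : ℤ, -600 ≤ x → x ≤ 600 → -600 ≤ σ * x ∧ σ * x ≤ 600 := fun x h1 h2 => by
    rw [← abs_le, abs_mul, hσabs, one_mul, abs_le]
    exact ⟨h1, h2⟩
  -- the claim for one candidate pair `(u, v)`
  have claim : ∀ u v : ℤ, (u = (gCand (pinRep H₀ g u₀) g₀ g₁ d).1 ∨ u = (gCand (pinRep H₀ g u₀) g₀ g₁ d).2) →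
      (v = (gCand (pinRep H₀ g u₀) g₀ g₁ (d + dm)).1 ∨ v = (gCand (pinRep H₀ g u₀) g₀ g₁ (d + dm)).2) →
      symTabAt σ (outTR yms T) (d, a0, a1, dm) u v ≤ (PT.findR (codeKO (d, a0, a1, dm)) B : ℤ) ∧
        symTabAt σ (outTN yms T) (d, a0, a1, dm) u v ≤ (PT.findN (codeKO (d, a0, a1, dm)) B : ℤ) := by
    intro u v hu hv
    have hu1 : |u| ≤ 1 := by rcases hu with rfl | rfl; exacts [(abs_gCand_le hrg d).1, (abs_gCand_le hrg d).2]
    have hv1 : |v| ≤ 1 := by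
      rcases hv with rfl | rfl; exacts [(abs_gCand_le hrg (d + dm)).1, (abs_gCand_le hrg (d + dm)).2]
    rw [abs_le] at hu1 hv1
    have hr2 := hbnd (a0 - (v - u)) (by omega) (by omega)
    have hr3 := hbnd (a1 - (v - u)) (by omega) (by omega)
    obtain ⟨e0, e1, e2, e3⟩ := digits_codeKO (k := (d, σ * (a0 - (v - u)), σ * (a1 - (v - u)), dm))
      (by simp only; omega) (by simp only; omega) hr2.1 hr2.2 hr3.1 hr3.2 (by simp only; omega) (by simp only; omega)
    simp only at e0 e1 e2 e3
    show outTR yms T (d, σ * (a0 - (v - u)), σ * (a1 - (v - u)), dm) ≤ _ ∧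
      outTN yms T (d, σ * (a0 - (v - u)), σ * (a1 - (v - u)), dm) ≤ _
    rw [(outT_eq_aggAll T (d, σ * (a0 - (v - u)), σ * (a1 - (v - u)), dm) yms).1,
      (outT_eq_aggAll T (d, σ * (a0 - (v - u)), σ * (a1 - (v - u)), dm) yms).2]
    by_cases hz : tabR (aggAll T yms) (codeKO (d, σ * (a0 - (v - u)), σ * (a1 - (v - u)), dm)) = 0 ∧
        tabN (aggAll T yms) (codeKO (d, σ * (a0 - (v - u)), σ * (a1 - (v - u)), dm)) = 0
    · rw [hz.1, hz.2]
      exact ⟨by exact_mod_cast Nat.zero_le _, by exact_mod_cast Nat.zero_le _⟩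
    · obtain ⟨e, he, hecode⟩ := exists_entry_of_ne (not_and_or.mp hz)
      obtain ⟨hs1, hs2⟩ := tab_self ((pairwise_lt_of_strictCodes hstrict).imp fun h => Nat.ne_of_lt h) he
      have hce := hall e he
      unfold domEntryChk at hce
      have hD0 : dg0 e.1 = (d + 600).toNat := by rw [hecode]; omega
      have hD3 : dg0 e.1 + dg3 e.1 - 600 = (d + dm + 600).toNat := by rw [hecode]; omega
      have hu' : u ∈ candAt H₀ g u₀ g₀ g₁ (dg0 e.1) := by rw [hD0]; exact mem_candAt (by omega) hu
      have hv' : v ∈ candAt H₀ g u₀ g₀ g₁ (dg0 e.1 + dg3 e.1 - 600) := by rw [hD3]; exact mem_candAt (by omega) hv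
      have hin := List.all_eq_true.mp (List.all_eq_true.mp hce u hu') v hv'
      simp only [Bool.and_eq_true, Nat.ble_eq] at hin
      rw [hecode, e0, e1, e2, e3] at hin
      simp only [add_sub_cancel_right] at hin
      rw [unshiftK_shift hσ2] at hin
      rw [← hecode, hs1, hs2]
      exact ⟨by exact_mod_cast hin.1, by exact_mod_cast hin.2⟩
  unfold envTab
  dsimp only
  have c11 := claim _ _ (Or.inl rfl) (Or.inl rfl)
  have c12 := claim _ _ (Or.inl rfl) (Or.inr rfl)
  have c21 := claim _ _ (Or.inr rfl) (Or.inl rfl)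
  have c22 := claim _ _ (Or.inr rfl) (Or.inr rfl)
  exact ⟨max_le (max_le c11.1 c12.1) (max_le c21.1 c22.1), max_le (max_le c11.2 c12.2) (max_le c21.2 c22.2)⟩

/-! ### §3 the type contract with the common tables -/

/-- ★★ THE COMMON-TABLE CONTRACT: the class door's output for the class pair of a type, plus the two certificates of the classes
against the trees `BU`, `BD`, give the type contract with the COMMON tables `comTR/comTN H₀ BU BD`. [g101] -/
theorem kernelSlabSoundFE_common {uU uD : List ℕ} {H₀ R E G Mp : ℕ} {wd : List ℤ} {lo hi P9max : ℤ} {ymsU ymsD : List ℕ}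
    {TU TD : ℕ → List (ℕ × ℕ × ℕ)} {gU gD : ℤ → ℤ} {σU gU₀ gU₁ σD gD₀ gD₁ : ℤ} {BU BD : PT}
    (hG : 4 * P9max < 3 * (3 * (G : ℤ) + 1) ^ 2) (hMp6 : P9max < 6 * ((Mp : ℤ) + 1) ^ 2)
    (hHR : H₀ + R ≤ 600) (hG2 : G + 2 ≤ 600) (hRM : R + Mp ≤ 600) (hσU : σU * σU = 1) (hσD : σD * σD = 1)
    (hcU : domChk H₀ σU gU uU gU₀ gU₁ ymsU TU BU = true) (hcD : domChk H₀ σD gD uD gD₀ gD₁ ymsD TD BD = true)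
    (h : KernelSlabSoundFE H₀ R wd lo hi P9max E
      (fun k => envTab σU (pinRep H₀ gU uU) gU₀ gU₁ (outTR ymsU TU) k +
        envTab σD (pinRep H₀ gD uD) gD₀ gD₁ (outTR ymsD TD) (revKey H₀ k))
      fun k => envTab σU (pinRep H₀ gU uU) gU₀ gU₁ (outTN ymsU TU) k +
        envTab σD (pinRep H₀ gD uD) gD₀ gD₁ (outTN ymsD TD) (revKey H₀ k)) :
    KernelSlabSoundFE H₀ R wd lo hi P9max E (comTR H₀ BU BD) (comTN H₀ BU BD) :=
  kernelSlabSoundFE_mono_on hG hMp6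
    (fun k hk => add_le_add (dom_of_domChk hσU hHR hG2 hRM hcU k hk).1
      (dom_of_domChk hσD hHR hG2 hRM hcD _ (inKeyBox_revKey hk)).1)
    (fun k hk => add_le_add (dom_of_domChk hσU hHR hG2 hRM hcU k hk).2
      (dom_of_domChk hσD hHR hG2 hRM hcD _ (inKeyBox_revKey hk)).2)
    (fun k => (comTR_nonneg H₀ BU BD k).1) (fun k => (comTR_nonneg H₀ BU BD k).2) h

/-! ### §4 toy certificate (H₀ = 2): one unit entry at the key `(2, 0, 0, 1)`, `g ≡ 0`, a one-node tree -/

example : domChk 2 1 (fun _ => 0) [0, 1, 0] 0 0 [603] (fun _ => [(codeKO (2, 0, 0, 1), 3, 4)])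
    (PT.node PT.nil (codeKO (2, 0, 0, 1)) 3 4 PT.nil) = true := by decide

/-- the merge aggregates equal codes and keeps the order (toy). -/
example : mergeAgg [(1, 1, 0), (3, 1, 0)] [(1, 2, 5), (2, 1, 1)] = [(1, 3, 5), (2, 1, 1), (3, 1, 0)] := by decide

end Summit.AtomisticToContinuum.Crystallization.Theorems.ChartedZeroExcessLayeredLatticeLiouville.ThetaKernel
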